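import Literature.Analysis.FluidPDE.NSLerayHopf
import Literature.Analysis.FluidPDE.NSGalerkinEnstrophy2D
import Literature.Analysis.FluidPDE.NSHopfGalerkinLimit
import Literature.Analysis.FluidPDE.StatisticalSolutionEnergyEq
import Literature.Analysis.FluidPDE.LerayHopfSpectralMeasurability
import HarnessLib

/-!
# The Fourier–Galerkin scheme with a steady force; pairings and the enstrophy dissipation in
  the Galerkin limit

Trunk: FluidKinetic (`Literature/Analysis/FluidPDE`). Support file for the two-dimensional
enstrophy theory of Leray–Hopf solutions (Foias–Manley–Rosa–Temam 2001, Ch. II Thm. 7.4 and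
App. II.A (A.65); Kuksin–Shirikyan 2012, Thm. 2.1.13/2.1.18: "Its justification can be carried
out with the help of the Galerkin approximation"), built on the tree's Fourier–Galerkin proof of
Hopf's theorem (`NSHopfGalerkinExistence`, `NSHopfLimit`, `NSHopfEnergy`, `NSHopfGalerkinLimit`,
every dimension). Three dimension-independent pieces:

* `NS.exists_steady_galerkin_scheme` — for `ν > 0`, `u₀ ∈ L²` weakly divergence free and a
  steady `f ∈ L²`, the Galerkin systems driven by the *truncated* force `P_n f`
  (`Torus.fourierTruncate`; Constantin–Foias 1988, Ch. 8, (8.3)–(8.5), where the Galerkin system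
  is `du_m/dt + νAu_m + P_m B(u_m) = P_m f`) form a Hopf–Galerkin scheme
  (`NS.IsHopfGalerkinScheme`, so that `exists_limitField` / `isLerayHopfOn_limit` apply) **and**
  the coefficient curves are exported with their ODE, so that further identities — the 2-D
  enstrophy identity `NS.galerkin_enstrophy_identity_fin_two` — can be run along them (the
  tree's `NS.exists_isHopfGalerkinScheme` hides the curves behind an `∃`). With `P_n f` the
  enstrophy balance of the approximations has the force term `∫⟪P_n f, ΔU⟫ = ∫⟪Δf, U⟫` exactly.
* `IsHopfGalerkinScheme.tendsto_lintegral_pairing_sub`, `….tendsto_intervalIntegral_pairing` —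
  pairings with a fixed smooth field pass to the limit, `∫ₛᵗ∫⟪w, U n⟫ → ∫ₛᵗ∫⟪w, u⟫`, from the
  strong `L²ₜₓ` convergence `IsHopfGalerkinScheme.tendsto_lintegral_enorm_sub_sq`
  (Robinson–Rodrigo–Sadowski 2016, Thm. 4.4 Steps 3–4) and Young's inequality with a free
  parameter, exactly as the tree's `tendsto_lintegral_work_sub` / `tendsto_work`.
* `NS.eLaplacianNormSq_le_liminf_of_tendsto_mFourierCoeff` — Fatou for the enstrophy
  dissipation density `‖Δ·‖₂² = 16π⁴∑|k|⁴‖·̂(k)‖²` (`eLaplacianNormSq`) under coefficientwise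
  convergence (twin of `NS.eGradNormSq_le_liminf_of_tendsto_mFourierCoeff`).

The two-dimensional consequences (enstrophy bounds along the scheme and the enstrophy
inequality of the limit) are in `NSEnstrophyLimit2D`.

## Mathlib / tree search

Everything scheme-related is reused from the tree (`NS.exists_galerkin_solution`,
`NS.galerkin_test_identity`, `NS.galerkin_energy_identity`, `NS.galerkin_slice_props`,
`NS.continuousOn_stLift_realTrigPoly`, `NS.contDiff_stLift_realTrigPoly`,
`Torus.tendsto_lintegral_enorm_sq_fourierTruncate_sub`, `Torus.integral_inner_fourierTruncate_eq`,
`Torus.enorm_integral_inner_le_add`, `ENNReal.tendsto_zero_of_forall_le_ofReal_mul_add`,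
`ENNReal.tsum_le_liminf_tsum`); from Mathlib `tendsto_setIntegral_of_L1`. Nothing existed for
steady-force schemes with exported coefficient curves or for pairings with a fixed field
(searched `steady`, `pairing`, `tendsto_integral_inner` in `Literature/Analysis/FluidPDE`).

## References

* P. Constantin, C. Foias, *Navier–Stokes Equations*, Chicago 1988, Ch. 8, (8.3)–(8.9).
* J. C. Robinson, J. L. Rodrigo, W. Sadowski, *The three-dimensional Navier–Stokes equations*,
  CUP 2016, Thm. 4.4 (Steps 1–4), (4.13). [RobinsonRodrigoSadowski2016]
* C. Foias, O. Manley, R. Rosa, R. Temam, *Navier–Stokes Equations and Turbulence*, CUP 2001,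
  Ch. II Thm. 7.4, App. II.A (A.65). [FoiasManleyRosaTemam2001]

*Imports (module hygiene, 2026-08-16, refactor item `defn-NSLerayHopfOpenFacts`):* the hub
`Literature.Analysis.FluidPDE.NSLerayHopf` is imported explicitly (this file uses its
declarations), since `NSHopfGalerkin` — through which it used to arrive — no longer imports it.
-/

open MeasureTheory Set Filter UnitAddTorus
open scoped ENNReal NNReal InnerProductSpace Topology

noncomputable section

namespace Literature.Analysis.FluidPDE

section NS

open FunctionSpaces.Torus Torus

variable {d : Type*} [Fintype d] [DecidableEq d]

/-! ### The steady-force Galerkin scheme (every dimension) -/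

section Steady

/-- **The Galerkin approximations for a steady force, with their coefficient ODEs.** Let
`ν > 0`, `u₀ ∈ L²(T^d)` weakly divergence free and `f ∈ L²(T^d; ℝ^d)`. For every
order `n` let `α n` be the global solution of the `n`-th Fourier–Galerkin system
(`NS.exists_galerkin_solution`; Robinson–Rodrigo–Sadowski 2016, Thm. 4.4 Steps 1–2;
Constantin–Foias 1988, Ch. 8, (8.3)–(8.9), where the Galerkin system is driven by `P_n f`) from
the datum `(û₀(k))_{|k| ≤ n}`, driven by the *truncated* force coefficients `(f̂(k))_{|k| ≤ n}`
(constant in time). Then the fields `U n t = realTrigPoly (freqBall n) (α n t)` and the forces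
`F n t = P_n f` form a Hopf–Galerkin scheme for `(ν, f, u₀)` in the sense of
`IsHopfGalerkinScheme` (so that the limit machinery of `NSHopfLimit` / `NSHopfGalerkinLimit`
applies), and the coefficient curves `α n` are exported with their ODE — continuous on
`[0, ∞)`, in the Galerkin phase space, solving the Galerkin ODE on every `[0, T]` — so that
further identities (the 2-D enstrophy identity, `NS.galerkin_enstrophy_identity_fin_two`) can
be run on them. [cite: RobinsonRodrigoSadowski2016, Thm. 4.4 Steps 1–2] -/
theorem exists_steady_galerkin_scheme {ν : ℝ} (hν : 0 < ν)
    {u₀ : UnitAddTorus d → EuclideanSpace ℝ d} (hu₀ : MemLp u₀ 2 volume)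
    (hdiv : FunctionSpaces.Torus.IsWeaklyDivFree u₀) {f : UnitAddTorus d → EuclideanSpace ℝ d}
    (hf : MemLp f 2 volume) :
    ∃ α : (n : ℕ) → ℝ → ↥(freqBall (d := d) n) → EuclideanSpace ℂ d,
      (∀ n, α n 0 = fun k : ↥(freqBall (d := d) n) =>
        mFourierCoeff (FunctionSpaces.EuclideanSpace.complexify ∘ u₀) (k : d → ℤ)) ∧
      (∀ n t, α n t ∈ galerkinSubspace (freqBall n)) ∧
      (∀ n, ContinuousOn (α n) (Ici 0)) ∧
      (∀ n T, ∀ t ∈ Icc 0 T, HasDerivWithinAt (α n)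
        (galerkinRHS (freqBall n) ν
          (fun k => mFourierCoeff (FunctionSpaces.EuclideanSpace.complexify ∘ f) k) (α n t))
        (Icc 0 T) t) ∧
      IsHopfGalerkinScheme ν (fun _ => f) u₀ id (fun n _ => fourierTruncate n f)
        (fun n t => realTrigPoly (freqBall n) (coeffExt (freqBall n) (α n t))) := by
  have hS : ∀ n : ℕ, ∀ k ∈ freqBall (d := d) n, -k ∈ freqBall n := fun n =>
    neg_mem_freqBall_of_mem
  -- force coefficients (constant in time) and data
  set g : (n : ℕ) → ↥(freqBall (d := d) n) → EuclideanSpace ℂ d :=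
    fun n k => mFourierCoeff (FunctionSpaces.EuclideanSpace.complexify ∘ f) k with hg_def
  have hg_real : ∀ n, IsRealCoeff (g n) := fun n =>
    isRealCoeff_mFourierCoeff (hf.integrable one_le_two)
  set c₀ : (n : ℕ) → ↥(freqBall (d := d) n) → EuclideanSpace ℂ d :=
    fun n k => mFourierCoeff (FunctionSpaces.EuclideanSpace.complexify ∘ u₀) k with hc₀_def
  have hc₀ : ∀ n, c₀ n ∈ galerkinSubspace (freqBall (d := d) n) := fun n =>
    ⟨isRealCoeff_mFourierCoeff (hu₀.integrable one_le_two),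
      isSolenoidalCoeff_restrict (hdiv.isTransversal_mFourierCoeff hu₀ (freqBall n))⟩
  -- the global Galerkin solutions
  have hsol : ∀ n : ℕ, ∃ α : ℝ → ↥(freqBall (d := d) n) → EuclideanSpace ℂ d,
      α 0 = c₀ n ∧ (∀ t, α t ∈ galerkinSubspace (freqBall n)) ∧ ContinuousOn α (Ici 0) ∧
      ∀ T, ∀ t ∈ Icc 0 T, HasDerivWithinAt α (galerkinRHS (freqBall n) ν (g n) (α t))
        (Icc 0 T) t := fun n =>
    exists_galerkin_solution ν hν.le (hS n) (g := fun _ => g n) continuous_const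
      (fun _ => hg_real n) (hc₀ n)
  choose α hα0 hαmem hαcont hαderiv using hsol
  refine ⟨α, hα0, hαmem, hαcont, hαderiv, ?_⟩
  -- the truncated force as a real trigonometric polynomial with coefficients `g n`
  have hF : ∀ n, fourierTruncate n f = realTrigPoly (freqBall n) (coeffExt (freqBall n) (g n)) := by
    intro n
    rw [fourierTruncate_eq]
    exact (realTrigPoly_coeffExt_restrict _).symm
  -- the datum is the Fourier truncation
  have hU0 : ∀ n, realTrigPoly (freqBall n) (coeffExt (freqBall n) (α n 0)) =
      fourierTruncate n u₀ := by
    intro n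
    rw [hα0 n, fourierTruncate_eq]
    exact realTrigPoly_coeffExt_restrict _
  have hband : ∀ {n : ℕ} {a : UnitAddTorus d → EuclideanSpace ℝ d}, IsGalerkinMode n a →
      ∀ k ∉ freqBall (d := d) n,
        mFourierCoeff (FunctionSpaces.EuclideanSpace.complexify ∘ a) k = 0 :=
    fun ha k hk => ha.mFourierCoeff_eq_zero (not_mem_freqBall.1 hk)
  exact
    { tendsto_order := tendsto_id
      smooth_force := fun n => by
        rw [hF n]
        exact contDiff_stLift_realTrigPoly (g := fun _ => g n) contDiff_const
      tendsto_force := fun T hT => by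
        have h := tendsto_lintegral_enorm_sq_fourierTruncate_sub hf
        have heq : (fun n : ℕ => ∫⁻ t in Ioo 0 T, ∫⁻ x, ‖fourierTruncate n f x - f x‖ₑ ^ 2) =
            fun n => ENNReal.ofReal T * ∫⁻ x, ‖fourierTruncate n f x - f x‖ₑ ^ 2 := by
          funext n
          rw [setLIntegral_const, Real.volume_Ioo, sub_zero, mul_comm]
        rw [heq, ← mul_zero (ENNReal.ofReal T)]
        exact ENNReal.Tendsto.const_mul h (Or.inr ENNReal.ofReal_ne_top)
      continuousOn := fun n => continuousOn_stLift_realTrigPoly (hαcont n)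
      isGalerkinMode := fun n t _ =>
        have h := galerkin_slice_props (hS n) (hαmem n t)
        ⟨h.1, h.2.1, fun k hk => h.2.2.2 k (not_mem_freqBall.2 hk)⟩
      isWeaklyDivFree := fun n t _ => (galerkin_slice_props (hS n) (hαmem n t)).2.2.1
      galerkin := fun n a ha s t hs hst => by
        have h := galerkin_test_identity ν (hS n) (g := fun _ => g n) continuous_const
          (fun _ => hg_real n) (hαmem n) (hαderiv n) ha.isSmooth ha.isDivFree (hband ha) hs hst
        simpa only [hF] using h
      energy_eq := fun n s t hs hst => by
        have h := galerkin_energy_identity ν (hS n) (g := fun _ => g n) continuous_const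
          (fun _ => hg_real n) (hαmem n) (hαderiv n) hs hst
        simpa only [hF] using h
      initial_inner := fun n a ha => by
        rw [hU0 n]
        exact integral_inner_fourierTruncate_eq hu₀ (ha.isSmooth.memLp 2) (hband ha)
      tendsto_initial := by
        have heq : (fun n => eLpNorm (realTrigPoly (freqBall n) (coeffExt (freqBall n) (α n 0)) -
            u₀) 2 volume) = fun n => eLpNorm (fourierTruncate n u₀ - u₀) 2 volume := by
          funext n; rw [hU0 n]
        rw [heq]
        exact tendsto_eLpNorm_fourierTruncate_sub hu₀ }

end Steady

/-! ### Pairings with a fixed field pass to the limit -/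

section Pairing

variable {ν : ℝ} {f : ℝ → UnitAddTorus d → EuclideanSpace ℝ d}
  {u₀ : UnitAddTorus d → EuclideanSpace ℝ d} {N : ℕ → ℕ}
  {F U : ℕ → ℝ → UnitAddTorus d → EuclideanSpace ℝ d}
  {u : ℝ → UnitAddTorus d → EuclideanSpace ℝ d}

/-- **Pairings with a fixed continuous field converge in `L¹(0, T)`** along a Hopf–Galerkin
scheme converging coefficientwise to `u` (`ν > 0`): `∫₀ᵀ |∫⟪w, U n⟫ - ∫⟪w, u⟫| → 0`, because
`U n → u` strongly in `L²((0,T) × T^d)` (`IsHopfGalerkinScheme.tendsto_lintegral_enorm_sub_sq`,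
the Friedrichs/Aubin–Lions step of Robinson–Rodrigo–Sadowski 2016, Thm. 4.4 Step 3 (4.13)) and
`|∫⟪w, U n - u⟫| ≤ (2λ)⁻¹‖U n - u‖₂² + (λ/2)‖w‖₂²` for every `λ > 0`. [cite: RobinsonRodrigoSadowski2016, Thm. 4.4 Step 3 (4.13)] -/
theorem IsHopfGalerkinScheme.tendsto_lintegral_pairing_sub (hS : IsHopfGalerkinScheme ν f u₀ N F U)
    (hν : 0 < ν) (hu₀ : MemLp u₀ 2 volume)
    (hfm : AEStronglyMeasurable (stLift f) (volume.restrict (Ioi 0 ×ˢ univ)))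
    (hf₂ : ∀ T, 0 < T → ∫⁻ t in Ioo 0 T, ∫⁻ x, ‖f t x‖ₑ ^ 2 < ⊤)
    (hum : AEStronglyMeasurable (stLift u) (volume.restrict (Ioi 0 ×ˢ univ)))
    (hu : ∀ t, 0 ≤ t → MemLp (u t) 2 volume)
    (hc : ∀ t, 0 ≤ t → ∀ k, Tendsto
      (fun n => mFourierCoeff (FunctionSpaces.EuclideanSpace.complexify ∘ U n t) k)
      atTop (𝓝 (mFourierCoeff (FunctionSpaces.EuclideanSpace.complexify ∘ u t) k)))
    {w : UnitAddTorus d → EuclideanSpace ℝ d} (hw : Continuous w) {T : ℝ} (hT : 0 < T) :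
    Tendsto (fun n => ∫⁻ τ in Ioo 0 T,
      ‖(∫ x, ⟪w x, U n τ x⟫_ℝ) - ∫ x, ⟪w x, u τ x⟫_ℝ‖ₑ) atTop (𝓝 0) := by
  have hwm : MemLp w 2 volume := hw.memLp_of_hasCompactSupport (HasCompactSupport.of_compactSpace w)
  have hZ : Tendsto (fun n => ∫⁻ τ in Ioo 0 T, ∫⁻ x, ‖U n τ x - u τ x‖ₑ ^ 2) atTop (𝓝 0) :=
    hS.tendsto_lintegral_enorm_sub_sq hν hu₀ hfm hf₂ hum hu hc hT
  set W : ℝ≥0∞ := ∫⁻ x, ‖w x‖ₑ ^ 2 with hW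
  have hWfin : W < ⊤ := FunctionSpaces.Torus.lintegral_enorm_sq_lt_top_of_memLp hwm
  -- pointwise bound for every `λ > 0`
  have hpt : ∀ {lam : ℝ}, 0 < lam → ∀ n, ∀ᵐ τ ∂(volume.restrict (Ioo 0 T)),
      ‖(∫ x, ⟪w x, U n τ x⟫_ℝ) - ∫ x, ⟪w x, u τ x⟫_ℝ‖ₑ ≤
        ENNReal.ofReal (2 * lam)⁻¹ * (∫⁻ x, ‖U n τ x - u τ x‖ₑ ^ 2) +
          ENNReal.ofReal (lam / 2) * W := by
    intro lam hlam n
    filter_upwards [ae_restrict_mem measurableSet_Ioo] with τ hτ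
    have hτ0 : 0 ≤ τ := hτ.1.le
    have hUm : MemLp (U n τ) 2 volume := hS.memLp_slice n hτ0
    have hum' : MemLp (u τ) 2 volume := hu τ hτ0
    have i1 : Integrable (fun x => ⟪w x, U n τ x⟫_ℝ) volume := integrable_inner_of_memLp hwm hUm
    have i2 : Integrable (fun x => ⟪w x, u τ x⟫_ℝ) volume := integrable_inner_of_memLp hwm hum'
    have hdiff : (∫ x, ⟪w x, U n τ x⟫_ℝ) - ∫ x, ⟪w x, u τ x⟫_ℝ =
        ∫ x, ⟪U n τ x - u τ x, w x⟫_ℝ := by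
      rw [← integral_sub i1 i2]
      refine integral_congr_ae (ae_of_all _ fun x => ?_)
      dsimp only
      rw [inner_sub_left, real_inner_comm (w x) (U n τ x), real_inner_comm (w x) (u τ x)]
    rw [hdiff]
    exact enorm_integral_inner_le_add (hUm.sub hum').1 hwm.1 hlam
  have hm : ∀ n, AEMeasurable (fun τ => ∫⁻ x, ‖U n τ x - u τ x‖ₑ ^ 2)
      (volume.restrict (Ioo 0 T)) :=
    fun n => Torus.aemeasurable_lintegral_enorm_sub_sq (hS.aestronglyMeasurable_stLift n) hum T
  -- integrate in time
  have hint : ∀ {lam : ℝ}, 0 < lam → ∀ n,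
      ∫⁻ τ in Ioo 0 T, ‖(∫ x, ⟪w x, U n τ x⟫_ℝ) - ∫ x, ⟪w x, u τ x⟫_ℝ‖ₑ ≤
        ENNReal.ofReal lam * (ENNReal.ofReal T * W) +
          ENNReal.ofReal (2 * lam)⁻¹ * ∫⁻ τ in Ioo 0 T, ∫⁻ x, ‖U n τ x - u τ x‖ₑ ^ 2 := by
    intro lam hlam n
    calc ∫⁻ τ in Ioo 0 T, ‖(∫ x, ⟪w x, U n τ x⟫_ℝ) - ∫ x, ⟪w x, u τ x⟫_ℝ‖ₑ
        ≤ ∫⁻ τ in Ioo 0 T, (ENNReal.ofReal (2 * lam)⁻¹ * (∫⁻ x, ‖U n τ x - u τ x‖ₑ ^ 2) +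
            ENNReal.ofReal (lam / 2) * W) := lintegral_mono_ae (hpt hlam n)
      _ = ENNReal.ofReal (2 * lam)⁻¹ * (∫⁻ τ in Ioo 0 T, ∫⁻ x, ‖U n τ x - u τ x‖ₑ ^ 2) +
            ENNReal.ofReal (lam / 2) * (ENNReal.ofReal T * W) := by
          rw [lintegral_add_left' ((hm n).const_mul _), lintegral_const_mul'' _ (hm n),
            setLIntegral_const, Real.volume_Ioo, sub_zero]
          ring
      _ ≤ ENNReal.ofReal (2 * lam)⁻¹ * (∫⁻ τ in Ioo 0 T, ∫⁻ x, ‖U n τ x - u τ x‖ₑ ^ 2) +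
            ENNReal.ofReal lam * (ENNReal.ofReal T * W) := by
          gcongr
          linarith
      _ = _ := add_comm _ _
  refine ENNReal.tendsto_zero_of_forall_le_ofReal_mul_add (C := ENNReal.ofReal T * W)
    (ENNReal.mul_ne_top ENNReal.ofReal_ne_top hWfin.ne)
    (X := fun lam n => ENNReal.ofReal (2 * lam)⁻¹ *
      ∫⁻ τ in Ioo 0 T, ∫⁻ x, ‖U n τ x - u τ x‖ₑ ^ 2) (fun lam _ => ?_) (fun lam hlam => ?_)
  · have h := ENNReal.Tendsto.const_mul hZ (a := ENNReal.ofReal (2 * lam)⁻¹)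
      (Or.inr ENNReal.ofReal_ne_top)
    simpa using h
  · exact Eventually.of_forall fun n => hint hlam n

/-- **Time integrals of pairings with a fixed smooth field converge**:
`∫ₛᵗ∫⟪w, U n⟫ → ∫ₛᵗ∫⟪w, u⟫` for `0 ≤ s ≤ t ≤ T` (from the `L¹(0,T)` convergence
`tendsto_lintegral_pairing_sub`; Robinson–Rodrigo–Sadowski 2016, Thm. 4.4 Step 4). [cite: RobinsonRodrigoSadowski2016, Thm. 4.4 Step 4] -/
theorem IsHopfGalerkinScheme.tendsto_intervalIntegral_pairing
    (hS : IsHopfGalerkinScheme ν f u₀ N F U) (hν : 0 < ν) (hu₀ : MemLp u₀ 2 volume)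
    (hfm : AEStronglyMeasurable (stLift f) (volume.restrict (Ioi 0 ×ˢ univ)))
    (hf₂ : ∀ T, 0 < T → ∫⁻ t in Ioo 0 T, ∫⁻ x, ‖f t x‖ₑ ^ 2 < ⊤)
    (hum : AEStronglyMeasurable (stLift u) (volume.restrict (Ioi 0 ×ˢ univ)))
    (hu : ∀ t, 0 ≤ t → MemLp (u t) 2 volume)
    (hc : ∀ t, 0 ≤ t → ∀ k, Tendsto
      (fun n => mFourierCoeff (FunctionSpaces.EuclideanSpace.complexify ∘ U n t) k)
      atTop (𝓝 (mFourierCoeff (FunctionSpaces.EuclideanSpace.complexify ∘ u t) k)))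
    {w : UnitAddTorus d → EuclideanSpace ℝ d} (hw : IsSmooth w) {T : ℝ} (hT : 0 < T)
    {s t : ℝ} (hs : 0 ≤ s) (hst : s ≤ t) (htT : t ≤ T) :
    Tendsto (fun n => ∫ τ in s..t, ∫ x, ⟪w x, U n τ x⟫_ℝ) atTop
      (𝓝 (∫ τ in s..t, ∫ x, ⟪w x, u τ x⟫_ℝ)) := by
  have hL1 := hS.tendsto_lintegral_pairing_sub hν hu₀ hfm hf₂ hum hu hc hw.continuous hT
  have hwst : ContinuousOn (stLift (fun _ : ℝ => w)) (Ici 0 ×ˢ (univ : Set (EuclideanSpace ℝ d))) :=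
    (show Continuous fun p : ℝ × EuclideanSpace ℝ d => w (proj p.2) from
      hw.continuous.comp (continuous_proj.comp continuous_snd)).continuousOn
  have hint : ∀ n, Integrable (fun τ => ∫ x, ⟪w x, U n τ x⟫_ℝ) (volume.restrict (Ioo 0 T)) := by
    intro n
    have hcont : ContinuousOn (fun τ => ∫ x, ⟪w x, U n τ x⟫_ℝ) (Icc 0 T) :=
      (continuousOn_integral_inner_of_continuousOn_stLift (u := fun _ => w) hwst
        (hS.continuousOn n)).mono fun τ hτ => mem_Ici.2 hτ.1
    exact (hcont.integrableOn_Icc (μ := volume)).mono_set Ioo_subset_Icc_self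
  have hmeas : AEStronglyMeasurable (fun τ => ∫ x, ⟪w x, u τ x⟫_ℝ) (volume.restrict (Ioo 0 T)) :=
    Torus.aestronglyMeasurable_integral_inner (aestronglyMeasurable_stLift_const hw _) hum T
  have hconv := tendsto_setIntegral_of_L1 (μ := volume.restrict (Ioo 0 T))
    (fun τ => ∫ x, ⟪w x, u τ x⟫_ℝ) hmeas
    (F := fun n τ => ∫ x, ⟪w x, U n τ x⟫_ℝ) (Eventually.of_forall hint) hL1 (Ioo s t)
  have hset : ∀ g : ℝ → ℝ, ∫ τ in Ioo s t, g τ ∂(volume.restrict (Ioo 0 T)) = ∫ τ in s..t, g τ := by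
    intro g
    rw [Measure.restrict_restrict measurableSet_Ioo, Set.inter_eq_left.2 (Ioo_subset_Ioo hs htT),
      intervalIntegral.integral_of_le hst, integral_Ioc_eq_integral_Ioo]
  rw [hset] at hconv
  refine hconv.congr fun n => ?_
  exact hset _

end Pairing

/-! ### Fatou for the enstrophy dissipation, slicewise -/

section Fatou

variable {U : ℕ → ℝ → UnitAddTorus d → EuclideanSpace ℝ d}
  {u : ℝ → UnitAddTorus d → EuclideanSpace ℝ d}

omit [DecidableEq d] in
/-- **Fatou for the enstrophy dissipation, slicewise**: `‖Δu(t)‖₂² ≤ liminf_n ‖ΔU n(t)‖₂²` for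
`t ≥ 0` when every Fourier coefficient converges (Fatou for the series `16π⁴ ∑ |k|⁴‖·‖²`;
twin of `NS.eGradNormSq_le_liminf_of_tendsto_mFourierCoeff`). [folklore] -/
theorem eLaplacianNormSq_le_liminf_of_tendsto_mFourierCoeff
    (hc : ∀ t, 0 ≤ t → ∀ k, Tendsto
      (fun n => mFourierCoeff (FunctionSpaces.EuclideanSpace.complexify ∘ U n t) k)
      atTop (𝓝 (mFourierCoeff (FunctionSpaces.EuclideanSpace.complexify ∘ u t) k)))
    {t : ℝ} (ht : 0 ≤ t) :
    eLaplacianNormSq (u t) ≤ liminf (fun n => eLaplacianNormSq (U n t)) atTop := by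
  have h : ∀ v : UnitAddTorus d → EuclideanSpace ℝ d, eLaplacianNormSq v =
      ∑' k : d → ℤ, ENNReal.ofReal (16 * Real.pi ^ 4) *
        ((if k = 0 then 0 else ENNReal.ofReal (freqNormSq k ^ (2 : ℝ))) *
          ‖mFourierCoeff (FunctionSpaces.EuclideanSpace.complexify ∘ v) k‖ₑ ^ 2) := fun v => by
    rw [eLaplacianNormSq, Torus.eHomSobolevSeminorm_two_sq_eq_tsum', ENNReal.tsum_mul_left]
  simp_rw [h]
  refine ENNReal.tsum_le_liminf_tsum fun k => ?_
  refine ENNReal.Tendsto.const_mul ?_ (Or.inr ENNReal.ofReal_ne_top)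
  refine ENNReal.Tendsto.const_mul ?_ (Or.inr ?_)
  · exact ((ENNReal.continuous_pow 2).tendsto _).comp (hc t ht k).enorm
  · split_ifs <;> simp

end Fatou
end NS

end Literature.Analysis.FluidPDE

end
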